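import Literature.AlgebraicGeometry.Motives.HodgeLieCentreAlternatingTensor
import Literature.AlgebraicGeometry.Motives.HodgeLieCentreEigenvalueConjugates
import Literature.AlgebraicGeometry.Motives.MumfordTateGroupGaloisConjugates
import Literature.AlgebraicGeometry.Motives.MumfordTateInvariantsHodgeBasis
import HarnessLib

/-!
# Rational structure on the complexified tensor spaces `T^{a,0}_ℂ`: coordinate conjugation of group-antisymmetrised tensors,
# rational tensors from rational coordinates, Hodge classes by degree, and the slot count of a determinant tensor

Family `hodge`, layer `Literature/AlgebraicGeometry/Motives`.  THEOREMS ONLY (no definition, no named fact).  Written for the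
cell `pub-hodgecm2` (COR-CM), seat `b27` gen 55 (count-neutral Mumford–Tate-rank ladder, «the centre», part 4a: the tools of the
Galois descent of part 4b, `Motives/HodgeLieCentreDescent`).

`V` a finite-dimensional `ℚ`-vector space, `V_ℂ = ℂ ⊗ V`, `T^{a,0}_ℂ = V_ℂ^{⊗a} ⊗ (V_ℂ^∨)^{⊗0}` the complexified tensor space with its
comparison map `ι = tensorSpaceToBaseChange ℂ V a 0` and, for a `ℚ`-basis `b` of `V`, the RATIONAL tensor basis `E⁰` of `T^{a,0}_ℂ`
(`hodgeTensorBasis (1 ⊗ b) a 0`); «`𝓒[τ]`» denotes coordinate conjugation by `τ ∈ Aut(ℂ)` in `E⁰`, spelled out as the additive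
equivalence `E⁰.repr⁻¹ ∘ mapRange τ ∘ E⁰.repr` of `Motives/MumfordTateGroupGaloisConjugates` (no notation or definition is declared).
* §1 `repr_coordConj'`, `coordConj_smul'` — coordinates and `τ`-semilinearity of `𝓒[τ]` (any basis);
* §2 **`coordConj_antisym_tprod_tmul`** — `𝓒[τ] (A(⊗ᵢ xᵢ) ⊗ u₀) = A(⊗ᵢ (τ ⊗ 1) xᵢ) ⊗ u₀` for the group antisymmetriser `A` of
  part 1 (Deligne, LNM 900, I §3: `Aut(ℂ)` acts on `V ⊗ ℂ` through the coefficients, factor-wise on tensors);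
* §3 `eq_zero_of_tmul_tprod_fin_zero_eq_zero` — `t ⊗ (⊗_{∅}) = 0 ⟹ t = 0`;
* §4 `F_eq_span_of_basis_mem_piece` — a basis of `V_ℂ` subordinate to the Hodge decomposition is a graded basis:
  `F^q = span {e_k | q ≤ deg k}` (Deligne, Hodge II, 1.2.5; with the tree's `mem_hodgeClasses_of_mem_span_degree` of
  `Motives/ExtendedMumfordTateGroup` this reads off Hodge classes of `T^{a,b}` from total degrees);
* §5 `exists_tensorSpaceToBaseChange_eq_of_repr_mem_range` — a complex tensor with RATIONAL coordinates in `E⁰` is `ι s` for a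
  rational tensor `s` (Springer 11.1.4: the `ℚ`-structure `T^{a,0} ⊆ T^{a,0}_ℂ`);
* §6 `card_filter_sigma_eq`, **`sum_comp_sigma_eq`** — the SLOT COUNT: for slots `s = (k, j)`, `j < w(wt k)`, and an index
  `Y` sending the slot group `(λ, j)` injectively into the eigenvalue block `ρλ` (blocks of `ρλ` and `λ` equinumerous), every
  basis index `σ` is hit exactly `w(ρ⁻¹ wt σ)` times, so `Σ_s θ(Y s) = Σ_σ w(ρ⁻¹ wt σ) θ_σ`.

## References
* [Deligne1982HodgeCycles] P. Deligne, *Hodge cycles on abelian varieties*, LNM 900 (1982), I §3.1 and Prop. 3.4.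
  [cite: Deligne1982HodgeCycles, I §3.1 and Prop. 3.4]
* [DeligneHodgeII1971] P. Deligne, *Théorie de Hodge II*, Publ. Math. IHÉS 40 (1971), 1.1.12, 1.2.5. [cite: DeligneHodgeII1971, 1.1.12]
* [SpringerLAG1998] T. A. Springer, *Linear Algebraic Groups*, 2nd ed. (1998), 11.1.4. [cite: SpringerLAG1998, Prop. 11.1.4]
* [BourbakiAlgebraI1989] N. Bourbaki, *Algebra I. Chapters 1–3* (1989), II §3.9, III §5.5 (tensor products of families; the empty
  family). [cite: BourbakiAlgebraI1989, III §5.5]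
-/

noncomputable section

open scoped TensorProduct PiTensorProduct

namespace Literature.AlgebraicGeometry.Motives

universe u

/-! ### §1 Coordinate conjugation: coordinates and semilinearity -/

section Coord

variable (τ : ℂ ≃+* ℂ) {M : Type*} [AddCommMonoid M] [Module ℂ M] {I : Type*} (𝔅 : Module.Basis I ℂ M)

/-- Coordinates of `𝓒[τ,𝔅] m` are `τ` of the coordinates of `m`. [cite: Deligne1982HodgeCycles, I §3.1 and Prop. 3.4] -/
theorem repr_coordConj' (m : M) (i : I) :
    𝔅.repr (((Module.Basis.repr (𝔅)).toAddEquiv.trans ((Finsupp.mapRange.addEquiv (RingEquiv.toAddEquiv (τ))).trans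
      (Module.Basis.repr (𝔅)).toAddEquiv.symm)) m) i = τ (𝔅.repr m i) := by
  simp [AddEquiv.trans_apply]

/-- `𝓒[τ,𝔅]` is `τ`-semilinear: `𝓒(c · m) = τ(c) · 𝓒 m`. [cite: Deligne1982HodgeCycles, I §3.1 and Prop. 3.4] -/
theorem coordConj_smul' (c : ℂ) (m : M) :
    ((Module.Basis.repr (𝔅)).toAddEquiv.trans ((Finsupp.mapRange.addEquiv (RingEquiv.toAddEquiv (τ))).trans
      (Module.Basis.repr (𝔅)).toAddEquiv.symm)) (c • m) =
      τ c • ((Module.Basis.repr (𝔅)).toAddEquiv.trans ((Finsupp.mapRange.addEquiv (RingEquiv.toAddEquiv (τ))).trans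
        (Module.Basis.repr (𝔅)).toAddEquiv.symm)) m := by
  apply 𝔅.repr.injective
  ext i
  rw [repr_coordConj', map_smul, map_smul, Finsupp.smul_apply, Finsupp.smul_apply, repr_coordConj', smul_eq_mul,
    smul_eq_mul, map_mul]

end Coord

/-! ### §2 Coordinate conjugation of group-antisymmetrised tensors in the rational tensor basis -/

section Antisym

variable {V : Type u} [AddCommGroup V] [Module ℚ V] {ι : Type*} [Fintype ι] [DecidableEq ι] (b : Module.Basis ι ℚ V)
variable {a : ℕ} {β : Type*} [DecidableEq β] (grp : Fin a → β)
variable (A : Module.End ℂ (⨂[ℂ]^a (ℂ ⊗[ℚ] V)))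
  (hA : A = ∑ π ∈ Finset.univ.filter (fun π : Equiv.Perm (Fin a) => ∀ i, grp (π i) = grp i),
    ((Equiv.Perm.sign π : ℤ) : ℂ) • (PiTensorProduct.reindex ℂ (fun _ : Fin a => ℂ ⊗[ℚ] V) π).toLinearMap)

include hA in
/-- **Coordinate conjugation of a group-antisymmetrised tensor**: in the rational tensor basis `E⁰` of `T^{a,0}_ℂ` (built on
`1 ⊗ b`), `𝓒[τ, E⁰] (A(⊗ᵢ xᵢ) ⊗ u₀) = A(⊗ᵢ (τ ⊗ 1) xᵢ) ⊗ u₀` — coordinate conjugation in a rational basis is `τ ⊗ 1`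
(`coordConj_basis_eq_rTensor`), acts factor-wise on pure tensors (`coordConj_hodgeTensorBasis_tprod_tmul_tprod`), commutes with the
permutations of the slots and fixes the integers `sgn π`. [cite: Deligne1982HodgeCycles, I §3.1 and Prop. 3.4] -/
theorem coordConj_antisym_tprod_tmul (τ : ℂ ≃+* ℂ) (x : Fin a → ℂ ⊗[ℚ] V) (ψ : Fin 0 → Module.Dual ℂ (ℂ ⊗[ℚ] V)) :
    ((Module.Basis.repr (hodgeTensorBasis (Algebra.TensorProduct.basis ℂ b) a 0)).toAddEquiv.trans
      ((Finsupp.mapRange.addEquiv (RingEquiv.toAddEquiv (τ))).trans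
        (Module.Basis.repr (hodgeTensorBasis (Algebra.TensorProduct.basis ℂ b) a 0)).toAddEquiv.symm))
        (A (PiTensorProduct.tprod ℂ x) ⊗ₜ[ℂ] PiTensorProduct.tprod ℂ ψ) =
      A (PiTensorProduct.tprod ℂ fun i => (τ.toRingHom.toRatAlgHom.toLinearMap.rTensor V) (x i)) ⊗ₜ[ℂ]
        PiTensorProduct.tprod ℂ ψ := by
  classical
  have hcs := coordConj_smul' τ (hodgeTensorBasis (Algebra.TensorProduct.basis ℂ b) a 0)
  have hct := coordConj_hodgeTensorBasis_tprod_tmul_tprod (a := a) (c := 0) τ (Algebra.TensorProduct.basis ℂ b)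
  rw [antisym_tprod grp A hA, antisym_tprod grp A hA, TensorProduct.sum_tmul, TensorProduct.sum_tmul, map_sum]
  refine Finset.sum_congr rfl fun π _ => ?_
  rw [← TensorProduct.smul_tmul', ← TensorProduct.smul_tmul', hcs, map_intCast, hct]
  congr 2
  · congr 1
    funext i
    exact coordConj_basis_eq_rTensor τ b (x (π.symm i))
  · congr 1
    funext l
    exact Fin.elim0 l

end Antisym

/-! ### §3 Tensoring with the empty tensor product is injective -/

/-- `t ⊗ (⊗_{l ∈ ∅} ψ_l) = 0 ⟹ t = 0`: the empty tensor product is the base ring (Bourbaki, *Algebra* II §3.9 / III §5.5, the tensor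
product of the empty family is `K`; Mathlib's `PiTensorProduct.isEmptyEquiv`) and `M ⊗ K ≅ M`. [cite: BourbakiAlgebraI1989, III §5.5] -/
theorem eq_zero_of_tmul_tprod_fin_zero_eq_zero {K : Type*} [Field K] {M N : Type*} [AddCommGroup M] [Module K M]
    [AddCommGroup N] [Module K N] (t : M) (ψ : Fin 0 → N)
    (h : t ⊗ₜ[K] PiTensorProduct.tprod K ψ = (0 : M ⊗[K] (⨂[K]^0 N))) : t = 0 := by
  have key : (TensorProduct.rid K M) (TensorProduct.congr (LinearEquiv.refl K M) (PiTensorProduct.isEmptyEquiv (Fin 0))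
      (t ⊗ₜ[K] PiTensorProduct.tprod K ψ)) = t := by
    rw [TensorProduct.congr_tmul, PiTensorProduct.isEmptyEquiv_apply_tprod, LinearEquiv.refl_apply, TensorProduct.rid_tmul,
      one_smul]
  rw [← key, h, map_zero, map_zero]

namespace HodgeStructure

variable {V : Type u} [AddCommGroup V] [Module ℚ V] [Module.Finite ℚ V] {n : ℤ}

/-! ### §4 Graded bases and Hodge classes by degree -/

omit [Module.Finite ℚ V] in
/-- **A basis subordinate to the Hodge decomposition is a graded basis**: if `e_k ∈ V^{deg k, n − deg k}` for all `k`, then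
`F^q = span {e_k | q ≤ deg k}` (Deligne, Hodge II, 1.2.5: `F^q = ⊕_{i ≥ q} V^{i,n−i}`). [cite: DeligneHodgeII1971, 1.1.12] -/
theorem F_eq_span_of_basis_mem_piece (H : HodgeStructure V n) {S : Type*} [Fintype S] (e : Module.Basis S ℂ (ℂ ⊗[ℚ] V))
    (deg : S → ℤ) (he : ∀ k, e k ∈ H.piece (deg k) (n - deg k)) (q : ℤ) :
    H.F q = Submodule.span ℂ (e '' {k | q ≤ deg k}) := by
  classical
  have hpiece : ∀ i, H.piece i (n - i) ≤ Submodule.span ℂ (e '' {k | deg k = i}) := by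
    intro i x hx
    rw [Module.Basis.mem_span_image]
    intro k hk
    by_contra hne
    rw [Finset.mem_coe, Finsupp.mem_support_iff] at hk
    exact hk (coord_eq_zero_of_mem_of_ne e deg (fun j => H.piece j (n - j)) (iSupIndep_piece_holds H) he hx hne)
  apply le_antisymm
  · rw [F_eq_iSup_piece_holds H q]
    refine iSup₂_le fun i hi => (hpiece i).trans (Submodule.span_mono (Set.image_mono fun k hk => ?_))
    simp only [Set.mem_setOf_eq] at hk ⊢
    omega
  · rw [Submodule.span_le]
    rintro _ ⟨k, hk, rfl⟩
    exact (piece_le_F H _ _).trans (H.antitone_F hk) (he k)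

/-! ### §5 Rational coordinates ⟹ rational tensor -/

omit [Module.Finite ℚ V] in
/-- **A complex tensor with rational coordinates is the complexification of a rational tensor**: if all coordinates of
`t ∈ T^{a,c}_ℂ` in the rational tensor basis `E⁰` (on `1 ⊗ b`) are rational, then `t = ι s` for a rational `s ∈ T^{a,c}`
(`repr_tensorSpaceToBaseChange`: the coordinates of `ι s` are those of `s`). [cite: SpringerLAG1998, Prop. 11.1.4] -/
theorem exists_tensorSpaceToBaseChange_eq_of_repr_mem_range {ι : Type*} [Fintype ι] [DecidableEq ι]
    (b : Module.Basis ι ℚ V) {a c : ℕ} (t : hodgeTensorSpaceOver ℂ (ℂ ⊗[ℚ] V) a c)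
    (ht : ∀ x, (hodgeTensorBasis (Algebra.TensorProduct.basis ℂ b) a c).repr t x ∈ Set.range (algebraMap ℚ ℂ)) :
    ∃ s : hodgeTensorSpace V a c, tensorSpaceToBaseChange ℂ V a c s = t := by
  classical
  choose q hq using ht
  refine ⟨(hodgeTensorBasis b a c).equivFun.symm q, ?_⟩
  apply (hodgeTensorBasis (Algebra.TensorProduct.basis ℂ b) a c).ext_elem
  intro x
  rw [repr_tensorSpaceToBaseChange, ← Module.Basis.equivFun_apply, LinearEquiv.apply_symm_apply, hq]

/-! ### §6 The slot count of a determinant tensor -/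

/-- **The slot count.**  Slots `s = (k, j)` with `k ∈ Fin N`, `j < w (wt k)`; an index `Y` on the slots that sends every slot into
the eigenvalue block `ρ (wt k)` (`wt (Y s) = ρ (wt s.1)`) and is injective on every slot group `{(k, j) | wt k = λ}` (fixed `λ`,
`j`); blocks `λ` and `ρλ` equinumerous.  Then every `σ` is hit exactly `w (ρ⁻¹ (wt σ))` times: once by every group `(ρ⁻¹ wt σ, j)`
(a group is mapped injectively into a block of the same size, hence onto it). [cite: Deligne1982HodgeCycles, I §3.1 and Prop. 3.4] -/
theorem card_filter_sigma_eq {N : ℕ} (wt : Fin N → ℂ) (w : ℂ → ℕ) (ρ : ℂ ≃+* ℂ)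
    (hm : ∀ μ, (Finset.univ.filter fun k => wt k = ρ μ).card = (Finset.univ.filter fun k => wt k = μ).card)
    (Y : (Σ k : Fin N, Fin (w (wt k))) → Fin N) (h1 : ∀ s, wt (Y s) = ρ (wt s.1))
    (h2 : ∀ s s', wt s.1 = wt s'.1 → (s.2 : ℕ) = s'.2 → Y s = Y s' → s = s') (σ : Fin N) :
    (Finset.univ.filter fun s => Y s = σ).card = w (ρ.symm (wt σ)) := by
  classical
  set l0 := ρ.symm (wt σ) with hl0
  have hρl0 : ρ l0 = wt σ := by rw [hl0, RingEquiv.apply_symm_apply]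
  -- slots in the fibre lie over the block `l0`
  have hfib : ∀ s, Y s = σ → wt s.1 = l0 := by
    intro s hs
    apply ρ.injective
    rw [← h1 s, hs, hρl0]
  -- sigma extensionality from the two coordinates
  have hext : ∀ s s' : (Σ k : Fin N, Fin (w (wt k))), s.1 = s'.1 → (s.2 : ℕ) = s'.2 → s = s' := by
    rintro ⟨k, j⟩ ⟨k', j'⟩ hk hj
    dsimp only at hk hj
    subst hk
    simp only [Sigma.mk.injEq, heq_eq_eq, true_and]
    exact Fin.ext hj
  rw [← Fintype.card_fin (w l0), ← Finset.card_univ]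
  refine Finset.card_bij (fun s hs => ⟨(s.2 : ℕ), ?_⟩) (fun s hs => Finset.mem_univ _) ?_ ?_
  · have h := hfib s (Finset.mem_filter.1 hs).2
    exact s.2.isLt.trans_eq (congrArg w h)
  · intro s hs s' hs' hss'
    rw [Finset.mem_filter] at hs hs'
    have hv : (s.2 : ℕ) = s'.2 := by
      have := congrArg Fin.val hss'
      exact this
    exact h2 s s' (by rw [hfib s hs.2, hfib s' hs'.2]) hv (by rw [hs.2, hs'.2])
  · intro j _
    -- the group `(l0, j)` is mapped injectively into the block of `σ`, which has the same size, hence onto it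
    set G : Finset (Σ k : Fin N, Fin (w (wt k))) := Finset.univ.filter fun s => wt s.1 = l0 ∧ (s.2 : ℕ) = j with hG
    set B : Finset (Fin N) := Finset.univ.filter fun k => wt k = ρ l0 with hB
    have hGcard : G.card = (Finset.univ.filter fun k => wt k = l0).card := by
      refine Finset.card_bij (fun s _ => s.1) (fun s hs => ?_) ?_ ?_
      · rw [Finset.mem_filter] at hs ⊢
        exact ⟨Finset.mem_univ _, hs.2.1⟩
      · intro s hs s' hs' h
        rw [Finset.mem_filter] at hs hs'
        exact hext s s' h (by rw [hs.2.2, hs'.2.2])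
      · intro k hk
        rw [Finset.mem_filter] at hk
        have hjlt : (j : ℕ) < w (wt k) := by rw [hk.2]; exact j.isLt
        exact ⟨⟨k, ⟨j, hjlt⟩⟩, Finset.mem_filter.2 ⟨Finset.mem_univ _, hk.2, rfl⟩, rfl⟩
    have himage : G.image Y = B := by
      apply Finset.eq_of_subset_of_card_le
      · intro k hk
        rw [Finset.mem_image] at hk
        obtain ⟨s, hs, rfl⟩ := hk
        rw [Finset.mem_filter] at hs
        rw [hB, Finset.mem_filter]
        exact ⟨Finset.mem_univ _, by rw [h1 s, hs.2.1]⟩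
      · rw [Finset.card_image_of_injOn, hGcard, hB, hm l0]
        intro s hs s' hs' h
        rw [Finset.mem_coe, Finset.mem_filter] at hs hs'
        exact h2 s s' (by rw [hs.2.1, hs'.2.1]) (by rw [hs.2.2, hs'.2.2]) h
    have hσB : σ ∈ B := by rw [hB, Finset.mem_filter]; exact ⟨Finset.mem_univ _, hρl0.symm⟩
    rw [← himage, Finset.mem_image] at hσB
    obtain ⟨s, hs, hsσ⟩ := hσB
    rw [Finset.mem_filter] at hs
    exact ⟨s, Finset.mem_filter.2 ⟨Finset.mem_univ _, hsσ⟩, Fin.ext hs.2.2⟩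

/-- **The slot count in summed form**: under the hypotheses of `card_filter_sigma_eq`,
`Σ_s θ(Y s) = Σ_σ w(ρ⁻¹ wt σ) · θ_σ` for every `θ`. [cite: Deligne1982HodgeCycles, I §3.1 and Prop. 3.4] -/
theorem sum_comp_sigma_eq {N : ℕ} (wt : Fin N → ℂ) (w : ℂ → ℕ) (ρ : ℂ ≃+* ℂ)
    (hm : ∀ μ, (Finset.univ.filter fun k => wt k = ρ μ).card = (Finset.univ.filter fun k => wt k = μ).card)
    (Y : (Σ k : Fin N, Fin (w (wt k))) → Fin N) (h1 : ∀ s, wt (Y s) = ρ (wt s.1))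
    (h2 : ∀ s s', wt s.1 = wt s'.1 → (s.2 : ℕ) = s'.2 → Y s = Y s' → s = s') (θ : Fin N → ℤ) :
    ∑ s, θ (Y s) = ∑ σ, (w (ρ.symm (wt σ)) : ℤ) * θ σ := by
  classical
  rw [← Finset.sum_fiberwise' Finset.univ Y θ]
  refine Finset.sum_congr rfl fun σ _ => ?_
  rw [Finset.sum_const, card_filter_sigma_eq wt w ρ hm Y h1 h2 σ, nsmul_eq_mul]

end HodgeStructure

end Literature.AlgebraicGeometry.Motives

end
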